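import Summits.RiemannHypothesis.RiemannHypothesis.Theses.DisplacementPencil

/-!
# `DisplacementPencil.PencilDoubling` (crux, item stmt-RiemannHypothesis-17887): target-or-bust

Negative-side knowledge for the crux `PencilDoubling` of route `RiemannHypothesis/DisplacementPencil`
(refuter crux-attack at birth; helper file, supports 17887; no definitions, the rung predicate is inlined).

Write `Hyp c` for "the rung `P_c = c·Ξ + Ξ(·+i) + Ξ(·−i)` has only real zeros".  The crux AS FILED
(`∀ c ≥ 4, Hyp c → ∃ c' ≥ 2c, Hyp c'`) is logically `(∀ c ≥ 4, ¬Hyp c) ∨ PencilUnbounded`: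

* `displacementPencil_not_pencilUnbounded_of_not_pencilDoubling` — refuting the crux refutes the route
  TARGET (`PencilUnbounded → PencilDoubling` in three lines): the crux is not a strictly weaker cut;
* `displacementPencil_not_pencilDoubling_of_rung_of_not_pencilUnbounded` — ANY hyperbolic rung `c₀ ≥ 4`
  together with the failure of the target kills the crux (iterate the step, Archimedes);
* `displacementPencil_not_pencilDoubling_of_pencilBase_of_not_pencilUnbounded` — in particular
  `PencilBase → ¬PencilUnbounded → ¬PencilDoubling`;
* `displacementPencil_not_pencilDoubling_iff` — `¬PencilDoubling ↔ (∃ c ≥ 4, Hyp c) ∧ ¬PencilUnbounded`: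
  a refutation needs a CERTIFIED hyperbolic rung and the failure of the target; the route's kill
  criterion K2 (three consecutive failed doublings) cannot close the item as filed.

Numerical status (evidence files FLOODING.md, CERTIFIED-ZEROS.md, PencilDoublingLogic.lean on the item;
kit jobs j022897, j023033, j023122): close pairs of zeta zeros whose `S(t)` lies outside a unit window
("flood-signed", law `cos(πS − π/4 − arg ζ(3/2+it)) < 0`, 9–11 % of tiny lobes at height 10⁵–10⁶) make
`P_c` lose a real zero pair in its low region; non-real zero pairs of `P_c` were certified numerically
(winding number 2, located zero, residual ≤ 5·10⁻¹¹ at 20 digits) for all 22 tested `c ∈ [215, 65536]`,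
including every ladder rung `256, 512, …, 65536` (e.g. `P_256(44182.31200 ± 0.07237 i) = 0`), and kill-window
coverage predicts every `c ≥ 185` non-hyperbolic.  On that evidence the hyperbolic set is bounded, so the
second hypothesis of the lemmas below holds and the crux is false as soon as one rung in `[4, 184]` is
hyperbolic (the planner's own premise `PencilBase`).  None of this is formal: a Lean `¬PencilDoubling` needs
a certified hyperbolic rung and `¬PencilUnbounded` for ALL large `c`.
-/

noncomputable section

set_option linter.dupNamespace false

namespace Summit.RiemannHypothesis.RiemannHypothesis.Theorems

open Literature.NumberTheory.LFunctions
open Summit.RiemannHypothesis.RiemannHypothesis.Theses.DisplacementPencil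

/-- Refuting the crux refutes the route target: `PencilUnbounded` gives the crux outright (take
`C = 2c`). [folklore] -/
theorem displacementPencil_not_pencilUnbounded_of_not_pencilDoubling (h : ¬ PencilDoubling) :
    ¬ PencilUnbounded :=
  fun hu => h fun c _ _ => hu (2 * c)

/-- Any hyperbolic rung `c₀ ≥ 4` plus boundedness of the hyperbolic set (failure of the target) kills the
crux: iterating the step from `c₀` gives hyperbolic rungs `≥ c₀·2ⁿ`. [folklore] -/
theorem displacementPencil_not_pencilDoubling_of_rung_of_not_pencilUnbounded {c₀ : ℝ} (h4 : 4 ≤ c₀)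
    (h₀ : HasOnlyRealZeros (fun z : ℂ => (c₀ : ℂ) * riemannXiUpper z + riemannXiUpper (z + Complex.I) +
      riemannXiUpper (z - Complex.I)))
    (hb : ¬ PencilUnbounded) : ¬ PencilDoubling := by
  intro h
  apply hb
  have key : ∀ n : ℕ, ∃ c : ℝ, c₀ * 2 ^ n ≤ c ∧ 4 ≤ c ∧ HasOnlyRealZeros (fun z : ℂ =>
      (c : ℂ) * riemannXiUpper z + riemannXiUpper (z + Complex.I) + riemannXiUpper (z - Complex.I)) := by
    intro n
    induction n with
    | zero => exact ⟨c₀, by simp, h4, h₀⟩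
    | succ n ih =>
      obtain ⟨c, hcn, hc4, hc⟩ := ih
      obtain ⟨c', hc', hyp'⟩ := h c hc4 hc
      refine ⟨c', ?_, by linarith, hyp'⟩
      calc c₀ * 2 ^ (n + 1) = 2 * (c₀ * 2 ^ n) := by ring
        _ ≤ 2 * c := by linarith
        _ ≤ c' := hc'
  intro C
  obtain ⟨n, hn⟩ := pow_unbounded_of_one_lt (C / c₀) (by norm_num : (1 : ℝ) < 2)
  obtain ⟨c, hcn, -, hc⟩ := key n
  refine ⟨c, ?_, hc⟩
  have hc₀ : 0 < c₀ := by linarith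
  rw [div_lt_iff₀ hc₀] at hn
  linarith

/-- In particular the two rungs of the route's certificate shape cannot both hold once the target fails:
`PencilBase → ¬PencilUnbounded → ¬PencilDoubling`. [folklore] -/
theorem displacementPencil_not_pencilDoubling_of_pencilBase_of_not_pencilUnbounded (hbase : PencilBase)
    (hb : ¬ PencilUnbounded) : ¬ PencilDoubling := by
  have h₀ := hbase
  unfold PencilBase at h₀
  exact displacementPencil_not_pencilDoubling_of_rung_of_not_pencilUnbounded le_rfl (by simpa using h₀) hb

/-- What a refutation of the crux as filed requires, exactly: a hyperbolic rung `c ≥ 4` AND the failure of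
the route target. [folklore] -/
theorem displacementPencil_not_pencilDoubling_iff :
    ¬ PencilDoubling ↔
      (∃ c : ℝ, 4 ≤ c ∧ HasOnlyRealZeros (fun z : ℂ => (c : ℂ) * riemannXiUpper z +
        riemannXiUpper (z + Complex.I) + riemannXiUpper (z - Complex.I))) ∧ ¬ PencilUnbounded := by
  constructor
  · intro h
    refine ⟨?_, displacementPencil_not_pencilUnbounded_of_not_pencilDoubling h⟩
    by_contra hno
    exact h fun c hc hyp => absurd ⟨c, hc, hyp⟩ hno
  · rintro ⟨⟨c, hc, hyp⟩, hb⟩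
    exact displacementPencil_not_pencilDoubling_of_rung_of_not_pencilUnbounded hc hyp hb

end Summit.RiemannHypothesis.RiemannHypothesis.Theorems
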